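/-
Origin: expansion seat `prover-pub-hodgecm-mc-binder-2-g7-0`, handover #7 18:14Z md5 367aa3eac646 (272 l.; imports #6 + twins `Weil1964/AdelicThetaArchContinuity` (in PKG, RUN 35) and `GelbartRogawski1991/UnitaryDualPairThetaKernelCMTwist` (P-76.1 re-queue twin, RUN 36 K-1 — install AFTER it, like #3 after #K165); §1 `cmBlockFrameAt` (the block frame as ONE `≃L`), `cmBlockRepAt_apply_eq` (rfl), `cmArchWeilRep_eq_symm_cmBlockRepAt`, native-frame (J-smooth) `cmArchWeilRep_one_hypV_symm_tensorPi` / `tendsto_cmArchWeilRep_one_hypV_sub_div`; §2 (J-top) AT THE PIN `continuous_toThetaTop_cmPairRepTwist_tmul` (tree `continuous_toThetaTop_repWeilThetaDatum_tmul` + `adelicMpCont.isLFContinuous_omega`; hyp `hρ` = the wm-input binder); §3 `cmPairRepTwist_archProdHom_tmul` (ρ(u_𝔸) E(Ψ ⊗ f) = η(u_𝔸) • E(ω_∞(u) Ψ ⊗ f)) and HEADLINE `tendsto_toThetaTop_cmPairRepTwist_one_hypV_sub_div` (the W-boost slope IN THE Θ-INITIAL TOPOLOGY; hyps hρ, small datum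 hW₁ hc₁, sign facts, `hη` = η trivial on the boost curve); farm amalgam (3228 l.) rc 0 / 0 warn; headline axioms trio (`g7/certs/SmoothTheta_axioms.json`)) (`HOME/mc/pub-hodgecm-mc-binder-2/g7/pkg/HodgeCM/Model/HypCensus/SmoothTheta.lean`, md5 367aa3ea, 272 lines);
landed by the gen-12 packager (p-g12) in gate run 36 as `HodgeCM/Model/HypCensus/SmoothTheta.lean` (verbatim).
-/
/-
Origin: speedrun cell pub-hodgecm, MODEL-CONSTRUCTION sub-cell, lineage mc-binder-2 (rows A12/A34 of the binder ledger:
`hyp12` / `hyp34`), seat prover-pub-hodgecm-mc-binder-2-g7-0 (gen 7), 2026-08-19.  Target in PKG: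
`HodgeCM/Model/HypCensus/SmoothTheta.lean` (NEW additive leaf; imports this lineage's `SmoothBlock` and the K-1 twin of
`Weil1964/AdelicThetaArchContinuity` (in PKG since RUN 35) and of `GelbartRogawski1991/UnitaryDualPairThetaKernelCMTwist` (#K-row of
glue-2's P-76.1 re-queue)).  KERNEL only: 0 records / named facts / proof holes.
-/
import Summits.HodgeConjecture.HodgeCM.Model.HypCensus.SmoothBlock
import Literature.NumberTheory.Weil1964.AdelicThetaArchContinuity
import Literature.NumberTheory.GelbartRogawski1991.UnitaryDualPairThetaKernelCMTwist

/-!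
# Census kit (rows A12/A34), junctions (J-smooth) + (J-top): the `W`-side boost slope in the pin's native Schwartz space
# and in the `Θ`-initial topology of the adelic Schwartz–Bruhat space

`SmoothBlock` computes the CM pin's archimedean Weil datum along the `W`-side boost at a real place `v` in Konno–Konno's
block frame.  This leaf moves that statement to the currencies the END STATE speaks:

* §1 the block frame as ONE continuous linear equivalence **`cmBlockFrameAt`** `: 𝓢(Fin n → L⁺ ⊗ ℝ) ≃L[ℂ] 𝓢(ℝ^{DPIdx ⊕ rest})`
  with `cmBlockRepAt g f = F (cmArchWeilRep g (F⁻¹ f))` (`cmBlockRepAt_apply_eq`), and the NATIVE-FRAME forms of `SmoothBlock`: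
  **`cmArchWeilRep_one_hypV_symm_tensorPi`** (`ω_∞ (s(1,a_t)) (F⁻¹(Φ₁ ⊠ Φ₂)) = F⁻¹((hypOpW t Φ₁) ⊠ Φ₂)`) and
  **`tendsto_cmArchWeilRep_one_hypV_sub_div`** (slope `→ F⁻¹((hypOpWGen Φ₁) ⊠ Φ₂)` in `𝓢(Fin n → L⁺ ⊗ ℝ)`);
* §2 (J-top) at the pin: **`continuous_toThetaTop_cmPairRepTwist_tmul`** — for the NORMALISED adelic Weil representation of
  record `ρ = ω_ψ ∘ (s_pair ⊗ η)` (`cmPairRepTwist`, unitary-1's `wmInputCM₂b.ρ`) with Weil's theta majorants (the `hρ` binder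
  of the `wm` input), the archimedean slot `Φ_∞ ↦ E(Φ_∞ ⊗ Φ_f)` is continuous from `𝓢(X_∞)` into the `Θ`-initial topology
  (tree `continuous_toThetaTop_repWeilThetaDatum_tmul`, [Weil1964, n° 39, n° 41 Thm 6; Rudin1991, Thm 2.6], LF-continuity from
  `adelicMpCont.isLFContinuous_omega`);
* §3 the adelic value **`cmPairRepTwist_archProdHom_tmul`** (`ρ(u_𝔸) E(Ψ ⊗ f) = η(u_𝔸) • E(ω_∞(u) Ψ ⊗ f)`, from
  `ArchDatumCM.omega_cmPairSplitting_arch_map_tmul`) and the headline **`tendsto_toThetaTop_cmPairRepTwist_one_hypV_sub_div`**: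
  if `η` is trivial on the boost curve, `t⁻¹ • (ρ(s(1,a_t)_𝔸) E(Ψ ⊗ f) − E(Ψ ⊗ f)) → E(F⁻¹((hypOpWGen Φ₁) ⊠ Φ₂) ⊗ f)` IN THE
  `Θ`-INITIAL TOPOLOGY, `Ψ = F⁻¹(Φ₁ ⊠ Φ₂)` — the census field `HypSmoothSide.smooth` for the Weil theta model of the pin, up to
  the E-currency adapters (`wmOf'` / `WeilThetaModel.comap` are `rfl` on the action) and the printed-vector dictionary.

Hypotheses kept explicit (all discharged elsewhere or E-binders): the small datum `hW₁ hc₁` of the slot (`SmoothBlockSlot`), the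
sign facts `h₁V h₁W hV hW` (unitary-1 `frameD_sign_*`, `GoodCtx`), `hρ` (= `(W V c).hρ`), `hη` (the determinant twist is `1` on
`SU(1,1)`-boosts; (J-CMη-det∞), successor lemma).  Nothing here is a claim of PerL/QW8.  Style lint (L-notation): no `local notation`.
-/

set_option autoImplicit false

noncomputable section

open Filter Topology
open NumberField NumberField.InfinitePlace IsDedekindDomain MeasureTheory
open scoped Matrix
open scoped Kronecker Classical TensorProduct ComplexConjugate
open Literature.NumberTheory.Automorphic Literature.NumberTheory.Automorphic.UnitaryGroup Literature.NumberTheory.Weil1964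
open Literature.RepresentationTheory.HeisenbergGroup (polar Heisenberg symplecticGroup ofSymplectic)
open Literature.RepresentationTheory.KonnoKonno2007 Literature.RepresentationTheory.KonnoKonno2007.RealDualPair
open Literature.NumberTheory.GelbartRogawski1991 Literature.NumberTheory.GelbartRogawski1991.UnitaryDualPair
open Literature.Analysis.SegalBargmann Literature.Analysis.Distribution

namespace HodgeCM.Model.HypCensus

section CMPinSmoothTheta

variable (L : Type) [Field L] [NumberField L] [IsCMField L] {N M n : ℕ} (e : Fin N × Fin M ≃ Fin n)
variable (dV : Fin N → L) (hdV : ∀ i, IsCMField.complexConj L (dV i) = dV i) (hdV0 : ∀ i, dV i ≠ 0)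
variable (dW : Fin M → L) (hdW : ∀ i, IsCMField.complexConj L (dW i) = dW i) (hdW0 : ∀ i, dW i ≠ 0)
variable (hGR : (cmSplittingDatum L e dV hdV hdV0 dW hdW hdW0).CompatibleSplitting) (ι₁ : L →+* ℂ)
variable (v : {v : InfinitePlace ↥(maximalRealSubfield L) // v.IsReal})
variable {P' Q' R' S' : Type} [Fintype P'] [DecidableEq P'] [Fintype Q'] [DecidableEq Q'] [Fintype R'] [DecidableEq R']
  [Fintype S'] [DecidableEq S']
variable (eP : PosIdx (cmXV L dV hdV ι₁ v) ≃ P') (eQ : NegIdx (cmXV L dV hdV ι₁ v) ≃ Q')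
  (eR : PosIdx (cmXW L dV dW hdW ι₁ v) ≃ R') (eS : NegIdx (cmXW L dV dW hdW ι₁ v) ≃ S')

/-! ## §1 The block frame as one continuous linear equivalence; `SmoothBlock` in the native frame -/

/-- **the block frame at `v`** as ONE topological isomorphism `𝓢(Fin n → L⁺ ⊗ ℝ) ≃L[ℂ] 𝓢(ℝ^{DPIdx P' Q' R' S' ⊕ rest})`:
scaled Folland frame, then the place split at `v`, then the four-fold relabelling. -/
abbrev cmBlockFrameAt :
    SchwartzMap (Fin n → mixedEmbedding.mixedSpace (↥(maximalRealSubfield L))) ℂ ≃L[ℂ]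
      SchwartzMap (DPIdx P' Q' R' S' ⊕ (Fin n × {w : {w : InfinitePlace ↥(maximalRealSubfield L) // w.IsReal} // w ≠ v}) → ℝ) ℂ :=
  ((schwartzTransport (cmBigFrame L e dV hdV hdV0 dW hdW hdW0 ι₁)).trans
      (schwartzTransport (reindexCLE (cmBlockSplitAt L e dV hdV dW hdW ι₁ v)))).trans
    (schwartzTransport (reindexCLE (cmBlockRelabelAt L dV hdV dW hdW ι₁ v eP eQ eR eS)))

omit [DecidableEq P'] [DecidableEq Q'] [DecidableEq R'] [DecidableEq S'] in
/-- `cmBlockRepAt g f = F (cmArchWeilRep g (F⁻¹ f))` (definitional unfolding of the three `repTransport`s). -/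
theorem cmBlockRepAt_apply_eq
    (g : UnitaryGroup.arch (↥(maximalRealSubfield L)) L (IsCMField.complexConj L) N (Matrix.diagonal dV) ×
      UnitaryGroup.arch (↥(maximalRealSubfield L)) L (IsCMField.complexConj L) M (Matrix.diagonal dW))
    (f : SchwartzMap (DPIdx P' Q' R' S' ⊕
      (Fin n × {w : {w : InfinitePlace ↥(maximalRealSubfield L) // w.IsReal} // w ≠ v}) → ℝ) ℂ) :
    cmBlockRepAt L e dV hdV hdV0 dW hdW hdW0 hGR ι₁ v eP eQ eR eS g f =
      cmBlockFrameAt L e dV hdV hdV0 dW hdW hdW0 ι₁ v eP eQ eR eS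
        (cmArchWeilRep L e dV hdV hdV0 dW hdW hdW0 hGR g
          ((cmBlockFrameAt L e dV hdV hdV0 dW hdW hdW0 ι₁ v eP eQ eR eS).symm f)) := rfl

omit [DecidableEq P'] [DecidableEq Q'] [DecidableEq R'] [DecidableEq S'] in
/-- `cmArchWeilRep g Ψ = F⁻¹ (cmBlockRepAt g (F Ψ))`. -/
theorem cmArchWeilRep_eq_symm_cmBlockRepAt
    (g : UnitaryGroup.arch (↥(maximalRealSubfield L)) L (IsCMField.complexConj L) N (Matrix.diagonal dV) ×
      UnitaryGroup.arch (↥(maximalRealSubfield L)) L (IsCMField.complexConj L) M (Matrix.diagonal dW))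
    (Ψ : SchwartzMap (Fin n → mixedEmbedding.mixedSpace (↥(maximalRealSubfield L))) ℂ) :
    cmArchWeilRep L e dV hdV hdV0 dW hdW hdW0 hGR g Ψ =
      (cmBlockFrameAt L e dV hdV hdV0 dW hdW hdW0 ι₁ v eP eQ eR eS).symm
        (cmBlockRepAt L e dV hdV hdV0 dW hdW hdW0 hGR ι₁ v eP eQ eR eS g
          (cmBlockFrameAt L e dV hdV hdV0 dW hdW hdW0 ι₁ v eP eQ eR eS Ψ)) := by
  rw [cmBlockRepAt_apply_eq, ContinuousLinearEquiv.symm_apply_apply, ContinuousLinearEquiv.symm_apply_apply]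

variable
  (h₁V : ∃ i₀ : Fin N, (∀ i, i ≠ i₀ → 0 < (ι₁ (dV i)).re) ∨ ∀ i, i ≠ i₀ → (ι₁ (dV i)).re < 0)
  (h₁W : (∀ j, 0 < (ι₁ (dW j)).re) ∨ ∀ j, (ι₁ (dW j)).re < 0)
  (hV : ∀ τ : L →+* ℂ, InfinitePlace.mk τ ≠ InfinitePlace.mk ι₁ →
    (∀ i, 0 < (τ (dV i)).re) ∨ ∀ i, (τ (dV i)).re < 0)
  (hW : ∀ τ : L →+* ℂ, InfinitePlace.mk τ ≠ InfinitePlace.mk ι₁ →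
    (∃ j₀ : Fin M, ∀ j, j ≠ j₀ → 0 < (τ (dW j)).re) ∨ ∀ j, (τ (dW j)).re < 0)

include h₁V h₁W hV hW in
/-- **(J-smooth) in the native frame, exact value**: `ω_∞ (s(1,a_t)) (F⁻¹(Φ₁ ⊠ Φ₂)) = F⁻¹((hypOpW t Φ₁) ⊠ Φ₂)`.
[Folland1989, Prop. (1.43), §4.2 (4.23), (4.24), Prop. (4.39)] -/
theorem cmArchWeilRep_one_hypV_symm_tensorPi
    {ω₁ : Representation ℂ (Ginf P' Q' R' S') (SchwartzMap (DPIdx P' Q' R' S' → ℝ) ℂ)}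
    (hW₁ : IsArchWeilDatum (ι𝕎 P' Q' R' S') ω₁) (hc₁ : ∀ u, Continuous (ω₁ u)) (r₀ : R') (s₀ : S') (t : ℝ)
    (Φ₁ : SchwartzMap (DPIdx P' Q' R' S' → ℝ) ℂ)
    (Φ₂ : SchwartzMap (Fin n × {w : {w : InfinitePlace ↥(maximalRealSubfield L) // w.IsReal} // w ≠ v} → ℝ) ℂ) :
    cmArchWeilRep L e dV hdV hdV0 dW hdW hdW0 hGR
        (cmBlockSectionAt L dV hdV hdV0 dW hdW hdW0 ι₁ v eP eQ eR eS
          (((1 : UForm P' Q'), (hypV r₀ s₀ t : UForm R' S')) : Ginf P' Q' R' S'))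
        ((cmBlockFrameAt L e dV hdV hdV0 dW hdW hdW0 ι₁ v eP eQ eR eS).symm (tensorPi Φ₁ Φ₂)) =
      (cmBlockFrameAt L e dV hdV hdV0 dW hdW hdW0 ι₁ v eP eQ eR eS).symm (tensorPi (hypOpW P' Q' r₀ s₀ t Φ₁) Φ₂) := by
  rw [cmArchWeilRep_eq_symm_cmBlockRepAt L e dV hdV hdV0 dW hdW hdW0 hGR ι₁ v eP eQ eR eS,
    ContinuousLinearEquiv.apply_symm_apply,
    cmBlockRepAt_cmBlockSectionAt_one_hypV_tensorPi L e dV hdV hdV0 dW hdW hdW0 hGR ι₁ v eP eQ eR eS h₁V h₁W hV hW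
      hW₁ hc₁ r₀ s₀ t Φ₁ Φ₂]

include h₁V h₁W hV hW in
/-- **(J-smooth) in the native frame, the slope**: `t⁻¹ • (ω_∞ (s(1,a_t)) Ψ − Ψ) → F⁻¹((hypOpWGen Φ₁) ⊠ Φ₂)` in
`𝓢(Fin n → L⁺ ⊗ ℝ)`, `Ψ = F⁻¹(Φ₁ ⊠ Φ₂)`. [Folland1989, (4.24), Prop. (4.39)] -/
theorem tendsto_cmArchWeilRep_one_hypV_sub_div
    {ω₁ : Representation ℂ (Ginf P' Q' R' S') (SchwartzMap (DPIdx P' Q' R' S' → ℝ) ℂ)}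
    (hW₁ : IsArchWeilDatum (ι𝕎 P' Q' R' S') ω₁) (hc₁ : ∀ u, Continuous (ω₁ u)) (r₀ : R') (s₀ : S')
    (Φ₁ : SchwartzMap (DPIdx P' Q' R' S' → ℝ) ℂ)
    (Φ₂ : SchwartzMap (Fin n × {w : {w : InfinitePlace ↥(maximalRealSubfield L) // w.IsReal} // w ≠ v} → ℝ) ℂ) :
    Tendsto (fun t : ℝ => ((t : ℝ) : ℂ)⁻¹ •
        (cmArchWeilRep L e dV hdV hdV0 dW hdW hdW0 hGR
            (cmBlockSectionAt L dV hdV hdV0 dW hdW hdW0 ι₁ v eP eQ eR eS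
              (((1 : UForm P' Q'), (hypV r₀ s₀ t : UForm R' S')) : Ginf P' Q' R' S'))
            ((cmBlockFrameAt L e dV hdV hdV0 dW hdW hdW0 ι₁ v eP eQ eR eS).symm (tensorPi Φ₁ Φ₂)) -
          (cmBlockFrameAt L e dV hdV hdV0 dW hdW hdW0 ι₁ v eP eQ eR eS).symm (tensorPi Φ₁ Φ₂)))
      (𝓝[≠] 0)
      (𝓝 ((cmBlockFrameAt L e dV hdV hdV0 dW hdW hdW0 ι₁ v eP eQ eR eS).symm (tensorPi (hypOpWGen P' Q' r₀ s₀ Φ₁) Φ₂))) := by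
  have hT := tendsto_cmBlockRepAt_one_hypV_tensorPi_sub_div L e dV hdV hdV0 dW hdW hdW0 hGR ι₁ v eP eQ eR eS h₁V h₁W hV hW
    hW₁ hc₁ r₀ s₀ Φ₁ Φ₂
  have hL := ((cmBlockFrameAt L e dV hdV hdV0 dW hdW hdW0 ι₁ v eP eQ eR eS).symm.continuous.tendsto _).comp hT
  simp only [Function.comp_def, map_smul, map_sub] at hL
  refine hL.congr fun t => ?_
  rw [cmBlockRepAt_cmBlockSectionAt_one_hypV_tensorPi L e dV hdV hdV0 dW hdW hdW0 hGR ι₁ v eP eQ eR eS h₁V h₁W hV hW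
      hW₁ hc₁ r₀ s₀ t Φ₁ Φ₂,
    cmArchWeilRep_one_hypV_symm_tensorPi L e dV hdV hdV0 dW hdW hdW0 hGR ι₁ v eP eQ eR eS h₁V h₁W hV hW hW₁ hc₁ r₀ s₀ t Φ₁ Φ₂]

end CMPinSmoothTheta

/-! ## §2 (J-top) at the pin: the archimedean slot is continuous into the `Θ`-initial topology -/

section ThetaTopPin

variable (L : Type) [Field L] [NumberField L] [IsCMField L] {N M n : ℕ} (e : Fin N × Fin M ≃ Fin n)
variable (dV : Fin N → L) (hdV : ∀ i, IsCMField.complexConj L (dV i) = dV i) (hdV0 : ∀ i, dV i ≠ 0)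
variable (dW : Fin M → L) (hdW : ∀ i, IsCMField.complexConj L (dW i) = dW i) (hdW0 : ∀ i, dW i ≠ 0)
variable (hGR : (cmSplittingDatum L e dV hdV hdV0 dW hdW hdW0).CompatibleSplitting)
variable (η : CMAdelic L dV × CMAdelic L dW →* ℂˣ) (Γ : Set (CMAdelic L dV × CMAdelic L dW))

/-- **(J-top) at the CM pin.**  For the normalised adelic Weil representation of record `ρ = ω_ψ ∘ (s_pair ⊗ η)` with theta
majorants, `Φ_∞ ↦ E(Φ_∞ ⊗ Φ_f)` is continuous from `𝓢(X_∞)` into the `Θ`-initial topology of `𝒮(𝔸^n)`.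
[Weil1964, Chap. I n° 11, Chap. III n° 39, n° 41 Thm 6 p. 193; Rudin1991, Thm 2.6] -/
theorem continuous_toThetaTop_cmPairRepTwist_tmul
    (hρ : HasThetaMajorants fun (p : CMAdelic L dV × CMAdelic L dW) (Φ : CMSchwartz L n) =>
      cmPairRepTwist L e dV hdV hdV0 dW hdW hdW0 hGR η p Φ)
    (Φf : FinSB (↥(maximalRealSubfield L)) (Fin n)) :
    Continuous fun φ : SchwartzMap (Fin n → mixedEmbedding.mixedSpace (↥(maximalRealSubfield L))) ℂ =>
      (repWeilThetaDatum (↥(maximalRealSubfield L)) (Fin n)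
          (cmPairRepTwist L e dV hdV hdV0 dW hdW hdW0 hGR η).toHomUnits Γ).toThetaTop
        (piSchwartzBruhatEquiv (↥(maximalRealSubfield L)) (Fin n) (φ ⊗ₜ Φf)) :=
  continuous_toThetaTop_repWeilThetaDatum_tmul _ Γ hρ
    (fun p => adelicMpCont.isLFContinuous_omega (cmPairSplittingTwist L e dV hdV hdV0 dW hdW hdW0 hGR η p)) Φf

end ThetaTopPin

/-! ## §3 The adelic value and the slope in the `Θ`-initial topology -/

section ThetaSlope

variable (L : Type) [Field L] [NumberField L] [IsCMField L] {N M n : ℕ} (e : Fin N × Fin M ≃ Fin n)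
variable (dV : Fin N → L) (hdV : ∀ i, IsCMField.complexConj L (dV i) = dV i) (hdV0 : ∀ i, dV i ≠ 0)
variable (dW : Fin M → L) (hdW : ∀ i, IsCMField.complexConj L (dW i) = dW i) (hdW0 : ∀ i, dW i ≠ 0)
variable (hGR : (cmSplittingDatum L e dV hdV hdV0 dW hdW hdW0).CompatibleSplitting)
variable (η : CMAdelic L dV × CMAdelic L dW →* ℂˣ) (Γ : Set (CMAdelic L dV × CMAdelic L dW))

/-- **The normalised adelic action on the archimedean slot**: `ρ(u_𝔸) E(Ψ ⊗ f) = η(u_𝔸) • E(ω_∞(u) Ψ ⊗ f)` for every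
archimedean pair element `u`, `u_𝔸 = archProdHom u` (binder-2 (J-arch) `omega_cmPairSplitting_arch_map_tmul` + the twist
`cmPairRepTwist_apply_eq_smul`). [Weil1964, Chap. III n° 37–39; GelbartRogawski1991, §3.1 Remark p. 457] -/
theorem cmPairRepTwist_archProdHom_tmul
    (u : UnitaryGroup.arch (↥(maximalRealSubfield L)) L (IsCMField.complexConj L) N (Matrix.diagonal dV) ×
      UnitaryGroup.arch (↥(maximalRealSubfield L)) L (IsCMField.complexConj L) M (Matrix.diagonal dW))
    (Ψ : SchwartzMap (Fin n → mixedEmbedding.mixedSpace (↥(maximalRealSubfield L))) ℂ)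
    (f : FinSB (↥(maximalRealSubfield L)) (Fin n)) :
    cmPairRepTwist L e dV hdV hdV0 dW hdW hdW0 hGR η
        (archProdHom (↥(maximalRealSubfield L)) L (IsCMField.complexConj L) N M (Matrix.diagonal dV) (Matrix.diagonal dW) u)
        (piSchwartzBruhatEquiv (↥(maximalRealSubfield L)) (Fin n) (Ψ ⊗ₜ f)) =
      ((η (archProdHom (↥(maximalRealSubfield L)) L (IsCMField.complexConj L) N M (Matrix.diagonal dV) (Matrix.diagonal dW) u) :
          ℂˣ) : ℂ) •
        piSchwartzBruhatEquiv (↥(maximalRealSubfield L)) (Fin n)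
          (cmArchWeilRep L e dV hdV hdV0 dW hdW hdW0 hGR u Ψ ⊗ₜ f) := by
  rw [cmPairRepTwist_apply_eq_smul, cmPairRep_apply]
  exact congrArg _ (omega_cmPairSplitting_arch_map_tmul L e dV hdV hdV0 dW hdW hdW0 hGR u.1 u.2 Ψ f)

variable (ι₁ : L →+* ℂ) (v : {v : InfinitePlace ↥(maximalRealSubfield L) // v.IsReal})
variable {P' Q' R' S' : Type} [Fintype P'] [DecidableEq P'] [Fintype Q'] [DecidableEq Q'] [Fintype R'] [DecidableEq R']
  [Fintype S'] [DecidableEq S']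
variable (eP : PosIdx (cmXV L dV hdV ι₁ v) ≃ P') (eQ : NegIdx (cmXV L dV hdV ι₁ v) ≃ Q')
  (eR : PosIdx (cmXW L dV dW hdW ι₁ v) ≃ R') (eS : NegIdx (cmXW L dV dW hdW ι₁ v) ≃ S')
variable
  (h₁V : ∃ i₀ : Fin N, (∀ i, i ≠ i₀ → 0 < (ι₁ (dV i)).re) ∨ ∀ i, i ≠ i₀ → (ι₁ (dV i)).re < 0)
  (h₁W : (∀ j, 0 < (ι₁ (dW j)).re) ∨ ∀ j, (ι₁ (dW j)).re < 0)
  (hV : ∀ τ : L →+* ℂ, InfinitePlace.mk τ ≠ InfinitePlace.mk ι₁ →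
    (∀ i, 0 < (τ (dV i)).re) ∨ ∀ i, (τ (dV i)).re < 0)
  (hW : ∀ τ : L →+* ℂ, InfinitePlace.mk τ ≠ InfinitePlace.mk ι₁ →
    (∃ j₀ : Fin M, ∀ j, j ≠ j₀ → 0 < (τ (dW j)).re) ∨ ∀ j, (τ (dW j)).re < 0)

include h₁V h₁W hV hW in
/-- **HEADLINE — (J-smooth) + (J-top): the `W`-side boost slope of the Weil theta model of the CM pin IN THE `Θ`-INITIAL
TOPOLOGY.**  For the normalised representation `ρ = ω_ψ ∘ (s_pair ⊗ η)` with theta majorants `hρ`, a twist `η` trivial on the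
boost curve, the small datum of the slot, and `Ψ = F⁻¹(Φ₁ ⊠ Φ₂)`:
`t⁻¹ • (ρ(s(1,a_t)_𝔸) E(Ψ ⊗ f) − E(Ψ ⊗ f)) ⟶ E(F⁻¹((hypOpWGen Φ₁) ⊠ Φ₂) ⊗ f)` as `t → 0`, `t ≠ 0`, in `ThetaTop`.
[Weil1964, Chap. III n° 39, n° 41 Thm 6; Folland1989, (4.24), Prop. (4.39)] -/
theorem tendsto_toThetaTop_cmPairRepTwist_one_hypV_sub_div
    (hρ : HasThetaMajorants fun (p : CMAdelic L dV × CMAdelic L dW) (Φ : CMSchwartz L n) =>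
      cmPairRepTwist L e dV hdV hdV0 dW hdW hdW0 hGR η p Φ)
    {ω₁ : Representation ℂ (Ginf P' Q' R' S') (SchwartzMap (DPIdx P' Q' R' S' → ℝ) ℂ)}
    (hW₁ : IsArchWeilDatum (ι𝕎 P' Q' R' S') ω₁) (hc₁ : ∀ u, Continuous (ω₁ u)) (r₀ : R') (s₀ : S')
    (hη : ∀ t : ℝ, η (archProdHom (↥(maximalRealSubfield L)) L (IsCMField.complexConj L) N M (Matrix.diagonal dV)
      (Matrix.diagonal dW) (cmBlockSectionAt L dV hdV hdV0 dW hdW hdW0 ι₁ v eP eQ eR eS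
        (((1 : UForm P' Q'), (hypV r₀ s₀ t : UForm R' S')) : Ginf P' Q' R' S'))) = 1)
    (Φ₁ : SchwartzMap (DPIdx P' Q' R' S' → ℝ) ℂ)
    (Φ₂ : SchwartzMap (Fin n × {w : {w : InfinitePlace ↥(maximalRealSubfield L) // w.IsReal} // w ≠ v} → ℝ) ℂ)
    (f : FinSB (↥(maximalRealSubfield L)) (Fin n)) :
    Tendsto (fun t : ℝ => ((t : ℝ) : ℂ)⁻¹ •
        ((repWeilThetaDatum (↥(maximalRealSubfield L)) (Fin n)
              (cmPairRepTwist L e dV hdV hdV0 dW hdW hdW0 hGR η).toHomUnits Γ).toThetaTop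
            (cmPairRepTwist L e dV hdV hdV0 dW hdW hdW0 hGR η
              (archProdHom (↥(maximalRealSubfield L)) L (IsCMField.complexConj L) N M (Matrix.diagonal dV)
                (Matrix.diagonal dW) (cmBlockSectionAt L dV hdV hdV0 dW hdW hdW0 ι₁ v eP eQ eR eS
                  (((1 : UForm P' Q'), (hypV r₀ s₀ t : UForm R' S')) : Ginf P' Q' R' S')))
              (piSchwartzBruhatEquiv (↥(maximalRealSubfield L)) (Fin n)
                ((cmBlockFrameAt L e dV hdV hdV0 dW hdW hdW0 ι₁ v eP eQ eR eS).symm (tensorPi Φ₁ Φ₂) ⊗ₜ f))) -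
          (repWeilThetaDatum (↥(maximalRealSubfield L)) (Fin n)
              (cmPairRepTwist L e dV hdV hdV0 dW hdW hdW0 hGR η).toHomUnits Γ).toThetaTop
            (piSchwartzBruhatEquiv (↥(maximalRealSubfield L)) (Fin n)
              ((cmBlockFrameAt L e dV hdV hdV0 dW hdW hdW0 ι₁ v eP eQ eR eS).symm (tensorPi Φ₁ Φ₂) ⊗ₜ f))))
      (𝓝[≠] 0)
      (𝓝 ((repWeilThetaDatum (↥(maximalRealSubfield L)) (Fin n)
              (cmPairRepTwist L e dV hdV hdV0 dW hdW hdW0 hGR η).toHomUnits Γ).toThetaTop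
        (piSchwartzBruhatEquiv (↥(maximalRealSubfield L)) (Fin n)
          ((cmBlockFrameAt L e dV hdV hdV0 dW hdW hdW0 ι₁ v eP eQ eR eS).symm (tensorPi (hypOpWGen P' Q' r₀ s₀ Φ₁) Φ₂) ⊗ₜ
            f)))) := by
  have hcont := continuous_toThetaTop_cmPairRepTwist_tmul L e dV hdV hdV0 dW hdW hdW0 hGR η Γ hρ f
  have hnat := tendsto_cmArchWeilRep_one_hypV_sub_div L e dV hdV hdV0 dW hdW hdW0 hGR ι₁ v eP eQ eR eS h₁V h₁W hV hW
    hW₁ hc₁ r₀ s₀ Φ₁ Φ₂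
  have h := (hcont.tendsto _).comp hnat
  refine h.congr fun t => ?_
  simp only [Function.comp_def]
  rw [cmPairRepTwist_archProdHom_tmul, hη, Units.val_one, one_smul, ← TensorProduct.smul_tmul', TensorProduct.sub_tmul,
    map_smul, map_sub]
  rfl

end ThetaSlope

end HodgeCM.Model.HypCensus

end
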